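import Summits.Ventures.HodgeRepro2.T5SU11JacobiEvenProduct
import Summits.Ventures.HodgeRepro2.T5SU11JacobiPhaseMGF

/-!
# The moment generating function of the phase at the even parameters, in closed form:
`E_{k,2n+2}[e^{−h·log|a|}] = ((k−2)/(k+h−2)) · Π_{i<n} ((k+h+2i)(k−4−2i))/((k+2i)(k+h−4−2i))`

`T5SU11JacobiPhaseMGF.mgf_phase_eq_ratio` writes the moment generating function of the phase `s = log|a(g)|` under
`m_k φ_λ dν/m̂_k(λ)` as the ratio of transforms `m̂_{k+h}(λ)/m̂_k(λ)`; with the product form of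
`T5SU11JacobiEvenProduct.jacobi_even_eq_prod` at `λ = 2n + 2` this is the RATIONAL function

  **`E_{k,2n+2}[e^{−hs}] = ((k − 2)/(k + h − 2)) · Π_{i<n} ((k + h + 2i)(k − 4 − 2i))/((k + 2i)(k + h − 4 − 2i))`**

(`mgf_phase_even_eq`, for `k > 2n + 2`, `k + h > 2n + 2`), with simple poles at `h = 2 − k, 4 − k, …, 2n + 2 − k` — the
Laplace transform of the signed mixture of exponentials of rates `k − 2 − 2i` of `T5SU11JacobiPhaseLawEven`; at
`n = 1` it is `(k − 2)(k + h)(k − 4)/((k + h − 2) k (k + h − 4))` (`mgf_phase_four_eq`), and the derivative at `h = 0`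
recovers the mean phase of `T5SU11JacobiEvenProduct.mean_phase_even_eq`. Nothing is claimed about (N).

Blind lane: Mathlib + the HodgeRepro2 prefix only; no sorry; axioms ⊆ {propext, Classical.choice,
Quot.sound}.
-/

namespace Summit.Ventures.HodgeRepro2.T5SU11JacobiEvenMGF

open MeasureTheory Metric Set Filter Topology Finset
open T5SU11Unimodular T5SU11Fibration T5SU11Cartan T5HaarCircle T5BergmanCoefficient T5SU11FibrationHaar
  T5SU11SphericalFunction T5SU11JacobiEvenProduct T5SU11JacobiPhaseMGF
open scoped Real

section measure

variable [MeasurableSpace Circle] [BorelSpace Circle]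

/-- **The MGF of the phase at `λ = 2n + 2`**, for `k > 2n + 2` and `k + h > 2n + 2`:
`E_{k,2n+2}[e^{−hs}] = ((k − 2)/(k + h − 2)) · Π_{i<n} ((k + h + 2i)(k − 4 − 2i))/((k + 2i)(k + h − 4 − 2i))`. -/
theorem mgf_phase_even_eq (n : ℕ) {k h : ℝ} (hk : 2 * (n : ℝ) + 2 < k) (hkh : 2 * (n : ℝ) + 2 < k + h) :
    (∫ g, Real.exp (-(h * Real.log ‖mat g 0 0‖)) * ((1 - ‖orbit g‖ ^ 2) ^ (k / 2) * sph (2 * (n : ℝ) + 2) g)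
        ∂(nu haarCircle)) / ∫ g, (1 - ‖orbit g‖ ^ 2) ^ (k / 2) * sph (2 * (n : ℝ) + 2) g ∂(nu haarCircle)
      = (k - 2) / (k + h - 2)
        * ∏ i ∈ range n, ((k + h + 2 * i) * (k - 4 - 2 * i)) / ((k + 2 * i) * (k + h - 4 - 2 * i)) := by
  rw [mgf_phase_eq_ratio, jacobi_even_eq_prod n hk, jacobi_even_eq_prod n hkh, evenProd, evenProd]
  have hn : (0 : ℝ) ≤ n := Nat.cast_nonneg n
  have h2 : k - 2 ≠ 0 := by intro h; linarith
  have h2' : k + h - 2 ≠ 0 := by intro h; linarith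
  have hπ : (2 * π : ℝ) ≠ 0 := by positivity
  have hf : ∀ i ∈ range n, (k + 2 * i) / (k - 4 - 2 * i) ≠ 0 := fun i hi =>
    (div_pos (factor_pos hk hi).1 (factor_pos hk hi).2).ne'
  have hf' : ∀ i ∈ range n, (k + h + 2 * i) ≠ 0 ∧ (k + h - 4 - 2 * i) ≠ 0 := fun i hi =>
    ⟨(factor_pos hkh hi).1.ne', (factor_pos hkh hi).2.ne'⟩
  have e : ∏ i ∈ range n, ((k + h + 2 * i) * (k - 4 - 2 * i)) / ((k + 2 * i) * (k + h - 4 - 2 * i))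
      = (∏ i ∈ range n, (k + h + 2 * i) / (k + h - 4 - 2 * i)) / ∏ i ∈ range n, (k + 2 * i) / (k - 4 - 2 * i) := by
    rw [← Finset.prod_div_distrib]
    refine Finset.prod_congr rfl fun i hi => ?_
    have := factor_pos hk hi
    have := factor_pos hkh hi
    field_simp
  rw [e]
  have hP : ∏ i ∈ range n, (k + 2 * i) / (k - 4 - 2 * i) ≠ 0 := Finset.prod_ne_zero_iff.mpr hf
  field_simp

/-- The cross-check `n = 1`: `E_{k,4}[e^{−hs}] = (k − 2)(k + h)(k − 4)/((k + h − 2) k (k + h − 4))`. -/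
theorem mgf_phase_four_eq {k h : ℝ} (hk : 4 < k) (hkh : 4 < k + h) :
    (∫ g, Real.exp (-(h * Real.log ‖mat g 0 0‖)) * ((1 - ‖orbit g‖ ^ 2) ^ (k / 2) * sph 4 g) ∂(nu haarCircle))
        / ∫ g, (1 - ‖orbit g‖ ^ 2) ^ (k / 2) * sph 4 g ∂(nu haarCircle)
      = (k - 2) * (k + h) * (k - 4) / ((k + h - 2) * k * (k + h - 4)) := by
  have hm := mgf_phase_even_eq 1 (k := k) (h := h) (by push_cast; linarith) (by push_cast; linarith)
  rw [show (2 * ((1 : ℕ) : ℝ) + 2) = 4 by norm_num] at hm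
  rw [hm, Finset.prod_range_one]
  simp only [Nat.cast_zero, mul_zero, add_zero, sub_zero]
  have h2 : k + h - 2 ≠ 0 := by intro h; linarith
  have h4 : k + h - 4 ≠ 0 := by intro h; linarith
  have h0 : k ≠ 0 := by intro h; linarith
  field_simp

end measure

end Summit.Ventures.HodgeRepro2.T5SU11JacobiEvenMGF
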